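import Literature.Barriers.Schanuel.NesterenkoModularScopeHolds
import Literature.Barriers.Schanuel.NesterenkoModularScopeConjecture
import Literature.NumberTheory.Transcendental.GelfondExpLogConjectureProofs
import HarnessLib

/-!
# The modular engine at the Schanuel nome `q = e⁻¹` (`τ = i/2π`)

The first open rung of Schanuel's conjecture is `SC(2)` at `z = (1, iπ)`, i.e. the algebraic
independence of `e` and `π` (`Literature.NumberTheory.Transcendental.ExpOnePiAlgebraicIndependent`,
`expOnePiAlgebraicIndependent_of_schanuel` in the tree).  The only transcendence engine that
outputs algebraic-independence statements at TRANSCENDENTAL points is the modular one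
(Nesterenko 1996 = LNM 1752 Ch. 3 Thm 1.1, a THEOREM of the tree: `nesterenko1996_thm_1_1_holds`):
`trdeg_ℚ ℚ(q, P(q), Q(q), R(q)) ≥ 3` for every `0 < |q| < 1`.  This file evaluates it at the
point of the modular curve that lies over the Schanuel point: the lattice `Λ = ℤπ ⊕ ℤ(i/2)` (one
period `π`, one ALGEBRAIC period `i/2`) has modular parameter `τ_S = (i/2)/π = i/(2π)`
(local notation `τS`) and nome `e^{2πiτ_S} = e^{-1}` (`cexp_schanuelTau`); with `ω₁ = π` the printed
dictionary `P = 3(ω₁/π)(η₁/π)`, `Q = (3/4)(ω₁/π)⁴g₂`, `R = (27/8)(ω₁/π)⁶g₃` (LNM 1752 Ch. 3 §1.2,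
p. 28) reads `P(e⁻¹) = 3η₁(Λ)/π`, `Q(e⁻¹) = (3/4)g₂(Λ)`, `R(e⁻¹) = (27/8)g₃(Λ)`.

* `three_le_trdeg_exp_one_ramanujan` (UNCONDITIONAL): `trdeg_ℚ ℚ(e, P(e⁻¹), Q(e⁻¹), R(e⁻¹)) ≥ 3`
  — at least two of the three Eisenstein values at the Schanuel nome are algebraically
  independent over `ℚ(e)`.  This is the modular engine's entire output at the point, and `π`
  does not occur in it: the engine reads `q = e^{2πiτ}` and the `q`-expansions at the cusp, never
  `τ = log q / 2πi` itself.
* `transcendental_schanuelTau`: `τ_S = i/(2π)` is transcendental (Lindemann, tree theorem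
  `transcendental_pi_mul_I`), in particular not imaginary quadratic: `Λ` has no CM, so none of
  the CM collapses `P, Q, R ∈ ℚ̄(π, ω, η)` that turn Theorem 1.1 into `π ⟂ e^{π√d}` is available.
* `three_lt_trdeg_of_conjecture_1_11`: what Nesterenko's (corrected) Conjecture 1.11 would add
  here — four algebraically independent numbers among `τ_S, e⁻¹, P(e⁻¹), Q(e⁻¹), R(e⁻¹)`, i.e.
  among `π, e, g₂(Λ), g₃(Λ), η₁(Λ)` up to the algebraic `i` — which still does NOT contain
  `e ⟂ π` (one relation among five numbers is allowed, and it may be the one between `e` and `π`).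
  The statement at this point that does contain `e ⟂ π` is the period conjecture for the
  1-motive `[ℤ → 𝔾ₘ] ⊕ h¹(E_Λ)` over `ℚ(e, g₂, g₃)` (all five independent), whose `[ℤ → 𝔾ₘ]`-part
  ALONE is already `e ⟂ π`; the elliptic factor contributes nothing toward it.

Atlas reading (solo seat `solo-Schanuel-informed`, §2 E4 (s11)): door E4 ("integral expansions at a
fixed point of the dynamics + multiplicity estimate") does evaluate at the Schanuel point, and its
value there is orthogonal to the summit's first rung.  No step toward Schanuel's conjecture is
claimed.
-/

noncomputable section

open Complex IntermediateField Polynomial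
open Literature.Barriers.Schanuel Literature.NumberTheory.Transcendental

namespace Summit.Schanuel.Schanuel.Theorems

/-! ### The modular parameter over the Schanuel point -/

/-- `τ_S = i/(2π)`: the ratio of the periods `i/2` and `π` of the lattice `ℤπ ⊕ ℤ(i/2)`; its nome
is `e^{2πiτ_S} = e^{-1}` (local notation, kept transparent so that every statement below is about
the explicit number `I / (2π)`). -/
local notation "τS" => (I / (2 * (Real.pi : ℂ)))

/-- `2π ≠ 0` in `ℂ`. [folklore] -/
theorem two_mul_pi_ne_zero : (2 * (Real.pi : ℂ)) ≠ 0 :=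
  mul_ne_zero two_ne_zero (Complex.ofReal_ne_zero.mpr Real.pi_ne_zero)

/-- `Im τ_S = 1/(2π)`. [folklore] -/
theorem schanuelTau_im : Complex.im τS = 1 / (2 * Real.pi) := by
  have h : (2 * (Real.pi : ℂ)) = ((2 * Real.pi : ℝ) : ℂ) := by push_cast; ring
  rw [h, Complex.div_ofReal_im, Complex.I_im]

/-- `τ_S` lies in the upper half plane. [folklore] -/
theorem schanuelTau_im_pos : 0 < Complex.im τS := by
  rw [schanuelTau_im]; positivity

/-- `2πi · τ_S = -1`. [folklore] -/
theorem two_pi_I_mul_schanuelTau : 2 * (Real.pi : ℂ) * I * τS = -1 := by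
  rw [show 2 * (Real.pi : ℂ) * I * (I / (2 * (Real.pi : ℂ)))
      = (I * I) * ((2 * (Real.pi : ℂ)) / (2 * (Real.pi : ℂ))) by ring,
    Complex.I_mul_I, div_self two_mul_pi_ne_zero]
  ring

/-- The nome of `τ_S` is `e^{-1}`. [folklore] -/
theorem cexp_schanuelTau : cexp (2 * Real.pi * I * τS) = cexp (-1) := by
  rw [two_pi_I_mul_schanuelTau]

/-- `τ_S ≠ 0`. [folklore] -/
theorem schanuelTau_ne_zero : τS ≠ 0 :=
  div_ne_zero Complex.I_ne_zero two_mul_pi_ne_zero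

/-- `τ_S⁻¹ = -2πi`. [folklore] -/
theorem schanuelTau_inv : τS⁻¹ = -2 * ((Real.pi : ℂ) * I) := by
  rw [inv_div, div_eq_mul_inv, Complex.inv_I]
  ring

/-- **`τ_S = i/(2π)` is transcendental** (so `ℤπ ⊕ ℤ(i/2)` is not a CM lattice and `τ_S` is not
imaginary quadratic): otherwise `τ_S⁻¹ = -2πi` and hence `πi` would be algebraic, contradicting
Lindemann (`transcendental_pi_mul_I`, tree). [cite: Lindemann1882, via BakerTNT1975 Ch. 1 Theorem 1.3, p. 5] -/
theorem transcendental_schanuelTau : Transcendental ℚ τS := by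
  intro halg
  apply transcendental_pi_mul_I
  rw [← mem_algebraicClosure_iff] at halg ⊢
  have hinv : τS⁻¹ ∈ algebraicClosure ℚ ℂ := inv_mem halg
  rw [schanuelTau_inv] at hinv
  have htwo : (2 : ℂ) ∈ algebraicClosure ℚ ℂ := ofNat_mem (algebraicClosure ℚ ℂ) 2
  have hmul := mul_mem (inv_mem (neg_mem htwo)) hinv
  have hid : (-2 : ℂ)⁻¹ * (-2 * ((Real.pi : ℂ) * I)) = (Real.pi : ℂ) * I := by
    rw [← mul_assoc, inv_mul_cancel₀ (by norm_num : (-2 : ℂ) ≠ 0), one_mul]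
  rwa [hid] at hmul

/-! ### Nesterenko's theorem at the nome `e⁻¹` -/

/-- `0 < |e^{-1}|`. [folklore] -/
theorem norm_cexp_neg_one_pos : 0 < ‖cexp (-1)‖ := by
  rw [Complex.norm_exp]; exact Real.exp_pos _

/-- `|e^{-1}| < 1`. [folklore] -/
theorem norm_cexp_neg_one_lt_one : ‖cexp (-1)‖ < 1 := by
  rw [Complex.norm_exp, Complex.neg_re, Complex.one_re]
  exact Real.exp_lt_one_iff.mpr (by norm_num)

/-- **Nesterenko at the Schanuel nome** (Theorem 1.1 of LNM 1752 Ch. 3 at `q = e^{-1}`, a tree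
theorem): `trdeg_ℚ ℚ(e⁻¹, P(e⁻¹), Q(e⁻¹), R(e⁻¹)) ≥ 3`.
[cite: NesterenkoPhilippon2001, Ch. 3 Theorem 1.1 (p. 27)] -/
theorem three_le_trdeg_ramanujan_exp_neg_one :
    (3 : Cardinal) ≤ Algebra.trdeg ℚ
      (adjoin ℚ ({cexp (-1), ramanujanP (cexp (-1)), ramanujanQ (cexp (-1)),
        ramanujanR (cexp (-1))} : Set ℂ)) :=
  nesterenko1996_thm_1_1_holds (cexp (-1)) norm_cexp_neg_one_pos norm_cexp_neg_one_lt_one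

/-- `ℚ(e⁻¹, a, b, c) = ℚ(e, a, b, c)` as subfields of `ℂ`. [folklore] -/
theorem adjoin_exp_neg_one_eq_adjoin_exp_one (a b c : ℂ) :
    adjoin ℚ ({cexp (-1), a, b, c} : Set ℂ) = adjoin ℚ ({cexp 1, a, b, c} : Set ℂ) := by
  apply le_antisymm
  · rw [adjoin_le_iff]
    intro x hx
    simp only [Set.mem_insert_iff, Set.mem_singleton_iff] at hx
    rcases hx with rfl | rfl | rfl | rfl
    · rw [Complex.exp_neg]
      exact inv_mem (subset_adjoin ℚ _ (by simp))
    all_goals exact subset_adjoin ℚ _ (by simp)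
  · rw [adjoin_le_iff]
    intro x hx
    simp only [Set.mem_insert_iff, Set.mem_singleton_iff] at hx
    rcases hx with rfl | rfl | rfl | rfl
    · rw [show cexp 1 = (cexp (-1))⁻¹ by rw [Complex.exp_neg, inv_inv]]
      exact inv_mem (subset_adjoin ℚ _ (by simp))
    all_goals exact subset_adjoin ℚ _ (by simp)

/-- **The modular engine's output at the Schanuel point, unconditionally**:
`trdeg_ℚ ℚ(e, P(e⁻¹), Q(e⁻¹), R(e⁻¹)) ≥ 3` — at least two of the Eisenstein values at the nome
`e⁻¹` of the lattice `ℤπ ⊕ ℤ(i/2)` (equivalently two of `g₂(Λ), g₃(Λ), η₁(Λ)/π`) are algebraically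
independent over `ℚ(e)`.  The number `π` does not occur.
[cite: NesterenkoPhilippon2001, Ch. 3 Theorem 1.1 (p. 27) and §1.2 (p. 28)] -/
theorem three_le_trdeg_exp_one_ramanujan :
    (3 : Cardinal) ≤ Algebra.trdeg ℚ
      (adjoin ℚ ({cexp 1, ramanujanP (cexp (-1)), ramanujanQ (cexp (-1)),
        ramanujanR (cexp (-1))} : Set ℂ)) := by
  rw [← adjoin_exp_neg_one_eq_adjoin_exp_one]
  exact three_le_trdeg_ramanujan_exp_neg_one

/-! ### What Conjecture 1.11 would add at this point -/

/-- **Nesterenko's corrected Conjecture 1.11 at `τ_S`**: since `τ_S` is not imaginary quadratic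
(`transcendental_schanuelTau`), the conjecture gives FOUR algebraically independent numbers among
`τ_S = i/(2π), e⁻¹, P(e⁻¹), Q(e⁻¹), R(e⁻¹)`.  (It does not give `e ⟂ π`: one algebraic relation
among the five numbers remains allowed.) [cite: NesterenkoPhilippon2001, Ch. 3 Conjecture 1.11 (PDF pp. 42-43)] -/
theorem three_lt_trdeg_of_conjecture_1_11 (h : NesterenkoConjecture_1_11_corrected) :
    (3 : Cardinal) < Algebra.trdeg ℚ
      (adjoin ℚ ({τS, cexp (-1), ramanujanP (cexp (-1)), ramanujanQ (cexp (-1)),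
        ramanujanR (cexp (-1))} : Set ℂ)) := by
  -- transport the conjecture from the nome `e^{2πiτ_S}` to `e^{-1}` along `cexp_schanuelTau`
  have key : ∀ q : ℂ, q = cexp (2 * Real.pi * I * τS) →
      Algebra.trdeg ℚ (adjoin ℚ ({τS, q, ramanujanP q, ramanujanQ q, ramanujanR q} : Set ℂ))
        ≤ (3 : Cardinal) → ∃ b c : ℚ, τS ^ 2 + (b : ℂ) * τS + (c : ℂ) = 0 := by
    intro q hq
    subst hq
    exact h τS schanuelTau_im_pos
  refine not_le.mp (fun hle => ?_)
  obtain ⟨b, c, hbc⟩ := key (cexp (-1)) cexp_schanuelTau.symm hle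
  apply transcendental_schanuelTau
  refine ⟨X ^ 2 + C b * X + C c, ?_, ?_⟩
  · intro h0
    have h2 := congr_arg (fun p : ℚ[X] => p.coeff 2) h0
    simp [Polynomial.coeff_X_pow] at h2
  · simp only [map_add, map_mul, map_pow, aeval_X, aeval_C, eq_ratCast]
    exact hbc

end Summit.Schanuel.Schanuel.Theorems

end
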